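import Summits.PneNP.PneNP.Theorems.ConvexRankGatesConvexGateBlindExactLiftingTriangleIsolationNDIdentity

/-!
# Triangle instance — line isolation with closeness on NONDEGENERATE rows only, file 2: the on-line bound

Support file for crux `ConvexGateBlind` (stmt-PneNP-10680), open stub `stub_exactLifting`; prover seat 0, session 35,
memo ANALYSIS14 §3. The chain `…IsolationOffLine` re-run for `IsLineFactND` (closeness only where `mu x ≠ 0`): the
off-point equation, pair differences, averaging over the good rows (their mass carries the factor `mu x`, so degenerate
rows never enter), and the on-line bound `μ₀ · S_on ≤ 6 (M·S_off + t·B̃ + η M (S_off + S_on))`. The only change of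
substance is in `sum_rest_le`, where the per-row estimate is proved with the weight `mu x` attached.
-/

set_option linter.dupNamespace false -- `Summit.PneNP.PneNP.…`: summit = sub-problem (D-0017)

namespace Summit.PneNP.PneNP.Theorems.XorDoor.TriLine.ND

open Finset

noncomputable section

variable {t : ℕ} {ε η : ℝ} {u : Line t → Col t → ℝ} {v : Line t → Tri t → ℝ}

/-- **Off-point equation**: at an off point of `x` on the monochromatic line `L`,
`Δ_L(w) + E_L(x) + ε = −rest(x,w)`. -/
lemma offeq (h : IsLineFactND t ε η u v) {x : Col t} {w : Tri t} (hoff : ¬ IsMono x w.1 w.2.1 w.2.2)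
    {L : Line t} (hL : lmem L w) (hm : lmono x L) :
    Dfn v L w + Efn u L x + ε = -rest u v x w := by
  have hs := star h x w
  have h1 : ∑ L', mInd x L' * Dfn v L' w = Dfn v L w + ∑ L', mInd x L' * ((1 - lind L' w) * Dfn v L' w) := by
    rw [← sum_mInd_lind_eq hoff hL hm (fun L' => Dfn v L' w), ← sum_add_distrib]
    refine sum_congr rfl fun L' _ => ?_; ring
  have h2 : ∑ L', Efn u L' x * lind L' w
      = Efn u L x + ∑ L', lind L' w * (if lmono x L' then 0 else Efn u L' x) := by
    rw [← sum_mInd_lind_eq hoff hL hm (fun L' => Efn u L' x), ← sum_add_distrib]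
    refine sum_congr rfl fun L' _ => ?_
    unfold mInd; split_ifs <;> ring
  unfold rest
  linarith [hs, h1, h2]

/-- **Pair differences**: two off points of the same monochromatic line under the same row. -/
lemma pair_diff (h : IsLineFactND t ε η u v) {x : Col t} {L : Line t} (hm : lmono x L) {w w' : Tri t}
    (hL : lmem L w) (hL' : lmem L w') (hoff : ¬ IsMono x w.1 w.2.1 w.2.2) (hoff' : ¬ IsMono x w'.1 w'.2.1 w'.2.2) :
    |Dfn v L w - Dfn v L w'| ≤ |rest u v x w| + |rest u v x w'| := by
  have e1 := offeq h hoff hL hm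
  have e2 := offeq h hoff' hL' hm
  have : Dfn v L w - Dfn v L w' = rest u v x w' - rest u v x w := by linarith
  rw [this]
  calc |rest u v x w' - rest u v x w| ≤ |rest u v x w'| + |rest u v x w| := abs_sub _ _
    _ = |rest u v x w| + |rest u v x w'| := add_comm _ _

/-- averaging the pair inequality over the good rows -/
lemma Gm_mul_abs_le (h : IsLineFactND t ε η u v) {L : Line t} {w w' : Tri t} (hL : lmem L w) (hL' : lmem L w') :
    Gm L w w' * |Dfn v L w - Dfn v L w'| ≤ ∑ x : Col t, mu x * (|rest u v x w| + |rest u v x w'|) := by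
  unfold Gm
  rw [sum_mul]
  refine sum_le_sum fun x _ => ?_
  split_ifs with hx
  · exact mul_le_mul_of_nonneg_left (pair_diff h hx.1 hL hL' hx.2.1 hx.2.2) (mu_nonneg x)
  · rw [zero_mul]; exact mul_nonneg (mu_nonneg x) (by positivity)

/-- mean zero: `t · S_on ≤ ∑_L ∑_{w,w'} 1_L(w) 1_L(w') |Δ_L(w) − Δ_L(w')|` -/
lemma t_mul_Son_le (h : IsLineFactND t ε η u v) :
    (t : ℝ) * Son v ≤ ∑ L : Line t, ∑ w : Tri t, ∑ w' : Tri t, lind L w * lind L w' * |Dfn v L w - Dfn v L w'| := by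
  unfold Son
  rw [mul_sum]
  refine sum_le_sum fun L _ => ?_
  rw [mul_sum]
  refine sum_le_sum fun w _ => ?_
  have hmean : (t : ℝ) * Dfn v L w = ∑ w', lind L w' * (Dfn v L w - Dfn v L w') := by
    simp only [mul_sub, sum_sub_distrib, sum_lind_mul_Dfn h L, ← sum_mul, sum_lind L, sub_zero]
  calc (t : ℝ) * (lind L w * |Dfn v L w|) = lind L w * |(t : ℝ) * Dfn v L w| := by
        rw [abs_mul, abs_of_nonneg (Nat.cast_nonneg (α := ℝ) t)]; ring
    _ ≤ lind L w * ∑ w', lind L w' * |Dfn v L w - Dfn v L w'| := by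
        refine mul_le_mul_of_nonneg_left ?_ (lind_nonneg L w)
        rw [hmean]
        refine (abs_sum_le_sum_abs _ _).trans (sum_le_sum fun w' _ => ?_)
        rw [abs_mul, abs_of_nonneg (lind_nonneg L w')]
    _ = ∑ w', lind L w * lind L w' * |Dfn v L w - Dfn v L w'| := by
        rw [mul_sum]; refine sum_congr rfl fun w' _ => ?_; ring

/-- averaging the pair differences: `μ₀ ∑_L ∑_{w,w'} 1 1 |Δ−Δ'| ≤ 6 t ∑_x μ(x) ∑_w |rest(x,w)|` -/
lemma muG_mul_pairs_le (h : IsLineFactND t ε η u v) :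
    muG t * ∑ L : Line t, ∑ w : Tri t, ∑ w' : Tri t, lind L w * lind L w' * |Dfn v L w - Dfn v L w'|
      ≤ 6 * t * ∑ x : Col t, mu x * ∑ w : Tri t, |rest u v x w| := by
  obtain ⟨R, hR⟩ : ∃ R : Tri t → ℝ, ∀ w, R w = ∑ x : Col t, mu x * |rest u v x w| := ⟨_, fun _ => rfl⟩
  have hRnn : ∀ w, 0 ≤ R w := fun w => by
    rw [hR]; exact sum_nonneg fun x _ => mul_nonneg (mu_nonneg x) (abs_nonneg _)
  -- termwise: `μ₀ 1 1 |Δ−Δ'| ≤ 1 1 (R w + R w')`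
  have key : ∀ L w w', muG t * (lind L w * lind L w' * |Dfn v L w - Dfn v L w'|)
      ≤ lind L w * lind L w' * (R w + R w') := by
    intro L w w'
    by_cases hL : lmem L w
    · by_cases hL' : lmem L w'
      · by_cases hne : w = w'
        · subst hne; simp only [sub_self, abs_zero, mul_zero]
          exact mul_nonneg (mul_nonneg (lind_nonneg _ _) (lind_nonneg _ _)) (add_nonneg (hRnn _) (hRnn _))
        · rw [lind_of_lmem hL, lind_of_lmem hL']
          have h1 := muG_le_Gm hL hL' hne
          have h2 := Gm_mul_abs_le h hL hL'
          have h3 : ∑ x : Col t, mu x * (|rest u v x w| + |rest u v x w'|) = R w + R w' := by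
            rw [hR, hR, ← sum_add_distrib]
            exact sum_congr rfl fun x _ => mul_add _ _ _
          calc muG t * (1 * 1 * |Dfn v L w - Dfn v L w'|) = muG t * |Dfn v L w - Dfn v L w'| := by ring
            _ ≤ Gm L w w' * |Dfn v L w - Dfn v L w'| := mul_le_mul_of_nonneg_right h1 (abs_nonneg _)
            _ ≤ R w + R w' := h2.trans_eq h3
            _ = 1 * 1 * (R w + R w') := by ring
      · rw [lind_of_not_lmem hL']; simp
    · rw [lind_of_not_lmem hL]; simp
  calc muG t * ∑ L : Line t, ∑ w : Tri t, ∑ w' : Tri t, lind L w * lind L w' * |Dfn v L w - Dfn v L w'|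
      ≤ ∑ L : Line t, ∑ w : Tri t, ∑ w' : Tri t, lind L w * lind L w' * (R w + R w') := by
        rw [mul_sum]; refine sum_le_sum fun L _ => ?_
        rw [mul_sum]; refine sum_le_sum fun w _ => ?_
        rw [mul_sum]; exact sum_le_sum fun w' _ => key L w w'
    _ = ∑ L : Line t, 2 * (t : ℝ) * ∑ w : Tri t, lind L w * R w := by
        refine sum_congr rfl fun L _ => ?_
        have hsplit : ∑ w : Tri t, ∑ w' : Tri t, lind L w * lind L w' * (R w + R w')
            = (∑ w : Tri t, lind L w * R w) * (∑ w' : Tri t, lind L w')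
              + (∑ w : Tri t, lind L w) * (∑ w' : Tri t, lind L w' * R w') := by
          rw [sum_mul, sum_mul, ← sum_add_distrib]
          refine sum_congr rfl fun w _ => ?_
          rw [mul_sum, mul_sum, ← sum_add_distrib]
          refine sum_congr rfl fun w' _ => ?_
          ring
        rw [hsplit, sum_lind L]; ring
    _ = 2 * (t : ℝ) * ∑ w : Tri t, (∑ L : Line t, lind L w) * R w := by
        rw [← mul_sum, sum_comm]; congr 1
        refine sum_congr rfl fun w _ => ?_; rw [sum_mul]
    _ = 6 * t * ∑ x : Col t, mu x * ∑ w : Tri t, |rest u v x w| := by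
        simp only [sum_lind_point]
        rw [show ∑ x : Col t, mu x * ∑ w : Tri t, |rest u v x w| = ∑ w : Tri t, R w by
          simp only [hR, mul_sum]; exact sum_comm]
        rw [mul_sum, mul_sum]
        refine sum_congr rfl fun w _ => ?_; ring

/-- the error terms, summed: `∑_x μ(x) ∑_w |rest(x,w)| ≤ M S_off + t B̃ + η M (S_off + S_on)` -/
lemma sum_rest_le (h : IsLineFactND t ε η u v) :
    ∑ x : Col t, mu x * ∑ w : Tri t, |rest u v x w| ≤ Mq t * Soff v + t * Bt u + η * Mq t * (Soff v + Son v) := by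
  have hη := h.eta_nonneg
  -- pointwise in `x`
  have hx : ∀ x : Col t, mu x ≠ 0 → ∑ w : Tri t, |rest u v x w|
      ≤ Soff v + (t : ℝ) * ∑ L : Line t, (if lmono x L then 0 else Efn u L x) + η * (Soff v + Son v) := by
    intro x hxμ
    have hw : ∀ w : Tri t, |rest u v x w| ≤ ∑ L, (1 - lind L w) * Dfn v L w
        + ∑ L, lind L w * (if lmono x L then 0 else Efn u L x) + η * ∑ L, |Dfn v L w| := by
      intro w
      unfold rest
      have p1 : ∀ L, 0 ≤ (1 - lind L w) * Dfn v L w := by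
        intro L; by_cases hm : lmem L w
        · rw [lind_of_lmem hm]; simp
        · rw [lind_of_not_lmem hm]; simpa using Dfn_nonneg_of_not_lmem h hm
      have p2 : ∀ L, 0 ≤ lind L w * (if lmono x L then 0 else Efn u L x) := by
        intro L; refine mul_nonneg (lind_nonneg L w) ?_
        split_ifs with hm; exact le_rfl; exact Efn_nonneg_of_not_lmono h hm
      have a1 : |∑ L, mInd x L * ((1 - lind L w) * Dfn v L w)| ≤ ∑ L, (1 - lind L w) * Dfn v L w := by
        refine (abs_sum_le_sum_abs _ _).trans (sum_le_sum fun L _ => ?_)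
        rw [abs_mul, abs_of_nonneg (p1 L)]
        unfold mInd; split_ifs <;> simp [p1 L]
      have a2 : |∑ L, lind L w * (if lmono x L then 0 else Efn u L x)|
          = ∑ L, lind L w * (if lmono x L then 0 else Efn u L x) := abs_of_nonneg (sum_nonneg fun L _ => p2 L)
      have a3 : |∑ L, Efn u L x * Dfn v L w| ≤ η * ∑ L, |Dfn v L w| := by
        refine (abs_sum_le_sum_abs _ _).trans ?_
        rw [mul_sum]
        refine sum_le_sum fun L _ => ?_
        rw [abs_mul]
        exact mul_le_mul_of_nonneg_right (h.close L x hxμ) (abs_nonneg _)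
      calc _ ≤ |∑ L, mInd x L * ((1 - lind L w) * Dfn v L w) + ∑ L, lind L w * (if lmono x L then 0 else Efn u L x)|
            + |∑ L, Efn u L x * Dfn v L w| := abs_add_le _ _
        _ ≤ |∑ L, mInd x L * ((1 - lind L w) * Dfn v L w)| + |∑ L, lind L w * (if lmono x L then 0 else Efn u L x)|
            + |∑ L, Efn u L x * Dfn v L w| := by gcongr; exact abs_add_le _ _
        _ ≤ _ := by rw [a2]; linarith [a1, a3]
    have hsum : Soff v + Son v = ∑ L : Line t, ∑ w : Tri t, |Dfn v L w| := by
      unfold Soff Son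
      rw [← sum_add_distrib]
      refine sum_congr rfl fun L _ => ?_
      rw [← sum_add_distrib]
      exact sum_congr rfl fun w _ => (abs_Dfn_eq h L w).symm
    calc ∑ w : Tri t, |rest u v x w| ≤ ∑ w : Tri t, (∑ L, (1 - lind L w) * Dfn v L w
          + ∑ L, lind L w * (if lmono x L then 0 else Efn u L x) + η * ∑ L, |Dfn v L w|) := sum_le_sum fun w _ => hw w
      _ = Soff v + (t : ℝ) * ∑ L : Line t, (if lmono x L then 0 else Efn u L x) + η * (Soff v + Son v) := by
          rw [sum_add_distrib, sum_add_distrib]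
          have e1 : ∑ w : Tri t, ∑ L : Line t, (1 - lind L w) * Dfn v L w = Soff v := by
            rw [Soff, sum_comm]
          have e2 : ∑ w : Tri t, ∑ L : Line t, lind L w * (if lmono x L then 0 else Efn u L x)
              = (t : ℝ) * ∑ L : Line t, (if lmono x L then 0 else Efn u L x) := by
            rw [sum_comm, mul_sum]
            refine sum_congr rfl fun L _ => ?_
            rw [← sum_mul, sum_lind L]
          have e3 : ∑ w : Tri t, η * ∑ L : Line t, |Dfn v L w| = η * (Soff v + Son v) := by
            rw [hsum, ← mul_sum, sum_comm]
          rw [e1, e2, e3]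
  -- sum over `x` with weights `μ(x)`
  calc ∑ x : Col t, mu x * ∑ w : Tri t, |rest u v x w|
      ≤ ∑ x : Col t, mu x * (Soff v + (t : ℝ) * ∑ L : Line t, (if lmono x L then 0 else Efn u L x)
          + η * (Soff v + Son v)) := by
        refine sum_le_sum fun x _ => ?_
        by_cases hxμ : mu x = 0
        · rw [hxμ, zero_mul, zero_mul]
        · exact mul_le_mul_of_nonneg_left (hx x hxμ) (mu_nonneg x)
    _ = Mq t * Soff v + t * Bt u + η * Mq t * (Soff v + Son v) := by
        have e1 : ∑ x : Col t, mu x * Soff v = Mq t * Soff v := by rw [Mq, sum_mul]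
        have e2 : ∑ x : Col t, mu x * ((t : ℝ) * ∑ L : Line t, (if lmono x L then 0 else Efn u L x))
            = t * Bt u := by
          unfold Bt
          rw [mul_sum]
          refine sum_congr rfl fun x _ => ?_
          calc mu x * ((t : ℝ) * ∑ L : Line t, (if lmono x L then 0 else Efn u L x))
              = (t : ℝ) * ∑ L : Line t, mu x * (if lmono x L then 0 else Efn u L x) := by
                rw [mul_left_comm, mul_sum]
            _ = (t : ℝ) * ∑ L : Line t, (if lmono x L then 0 else Efn u L x * mu x) := by
                congr 1
                refine sum_congr rfl fun L _ => ?_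
                split_ifs <;> ring
        have e3 : ∀ S : ℝ, ∑ x : Col t, mu x * (η * S) = η * Mq t * S := by
          intro S
          rw [Mq, mul_sum, sum_mul]
          refine sum_congr rfl fun x _ => ?_
          ring
        simp only [mul_add, sum_add_distrib]
        rw [e1, e2, e3, e3]

/-- **The on-line bound**: `μ₀ · S_on ≤ 6 (M S_off + t B̃ + η M (S_off + S_on))`. -/
theorem muG_mul_Son_le (h : IsLineFactND t ε η u v) (ht : 0 < t) :
    muG t * Son v ≤ 6 * (Mq t * Soff v + t * Bt u + η * Mq t * (Soff v + Son v)) := by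
  have h1 := t_mul_Son_le h
  have h2 := muG_mul_pairs_le h
  have h3 := sum_rest_le h
  have htpos : (0 : ℝ) < t := by exact_mod_cast ht
  have hμ := muG_nonneg t
  -- `μ₀ t S_on ≤ μ₀ ∑∑∑ ≤ 6 t ∑ μ ∑ |rest| ≤ 6 t (...)`
  have h4 : muG t * ((t : ℝ) * Son v) ≤ 6 * t * (Mq t * Soff v + t * Bt u + η * Mq t * (Soff v + Son v)) := by
    calc muG t * ((t : ℝ) * Son v) ≤ muG t * ∑ L : Line t, ∑ w : Tri t, ∑ w' : Tri t,
          lind L w * lind L w' * |Dfn v L w - Dfn v L w'| := mul_le_mul_of_nonneg_left h1 hμ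
      _ ≤ 6 * t * ∑ x : Col t, mu x * ∑ w : Tri t, |rest u v x w| := h2
      _ ≤ 6 * t * (Mq t * Soff v + t * Bt u + η * Mq t * (Soff v + Son v)) := by
          refine mul_le_mul_of_nonneg_left h3 (by positivity)
  have h5 : (t : ℝ) * (muG t * Son v) ≤ (t : ℝ) * (6 * (Mq t * Soff v + t * Bt u + η * Mq t * (Soff v + Son v))) := by
    calc (t : ℝ) * (muG t * Son v) = muG t * ((t : ℝ) * Son v) := by ring
      _ ≤ _ := h4
      _ = _ := by ring
  exact le_of_mul_le_mul_left h5 htpos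

/-- **The on-line bound, nondegenerate-closeness form** (registered sub-goal `triangle_nd_online_bound` of
stmt-PneNP-10680, verbatim signature). -/
theorem triangle_nd_online_bound : ∀ (t : ℕ) (ε η : ℝ) (u : Line t → Col t → ℝ) (v : Line t → Tri t → ℝ),
    IsLineFactND t ε η u v → 0 < t → muG t * Son v ≤ 6 * (Mq t * Soff v + t * Bt u + η * Mq t * (Soff v + Son v)) :=
  fun _ _ _ _ _ h ht => muG_mul_Son_le h ht


end

end Summit.PneNP.PneNP.Theorems.XorDoor.TriLine.ND
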